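import Summits.ResolutionOfSingularities.ResolutionOfSingularities.Theorems.InvariantDescentLU3
import HarnessLib

/-!
# InvariantDescentLU4 (lens numbering: InvariantDescentLU part 3/3 = FILE 11) — GALOIS COORDINATES from the separating witness: étale descent of stable modules
(«Lagrange descent»; decomp-res lens-1 g28 preparation F; the engine of the WHOLE route NEXT-g29-E STEP 4)

Same frame as parts 1–2.  The Lagrange basis polynomial `ℓ₁(X) = ∏_{h ≠ 1} (X − h x)/(x − h x)` at the node `x`
satisfies `ℓ₁(h x) = δ_{h,1}`; writing `ℓ₁ = ∑_i a_i X^i` (`a_i` in the local ring `(T₁)_𝔪′`, part 2) gives the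
GALOIS COORDINATE SYSTEM `∑_i a_i · h(x^i) = δ_{h,1}` of the `H`-extension, whence the IDENTITY
  `n = ∑_{i < |H|} a_i · ∑_{h ∈ H} h(x^i · n)`   for EVERY `n ∈ E`   (`eq_sum_coeff_mul_orbitSum`),
whose inner sums are `H`-fixed (`apply_orbitSum_eq`, `orbitSum_mem_fixedField`).  Consequence
(`exists_sum_fixed_of_stable`): every element of an additive subgroup `N ⊆ E` stable under `H` and under
multiplication by `(T₁)_𝔪′` is a `(T₁)_𝔪′`-linear combination of `H`-FIXED elements of `N` — descent of
`H`-equivariant `(T₁)_𝔪′`-modules to the fixed field with no cohomology, no trace surjectivity hypothesis and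
no restriction on `|H|` (it may be divisible by the characteristic).  g29 applies it to the twisted isotypic
modules `N_χ = f_χ⁻¹ · 𝔪_χ ⊆ K_T` of a `G`-stable regular local ring to produce `G`-SEMI-INVARIANT
eigenparameters `f_χ · m`, `m ∈ K` (NEXT-g29-E).  (Sources: folklore; the Galois-coordinate formalism is
Chase–Harrison–Rosenberg's, here made explicit by Lagrange interpolation.)

WRITER NOTE (decomp-res writer g13): this is the lens's FILE 11 `land/InvariantDescentLU3.lean` (sha256 9ce7e3d8,
143 l; HOME/decomp-res-lens-1/g28,
WRITER-F.md, LANDING NOTE INBOX 2026-08-31T12:23:43Z). It lands as `Theorems/InvariantDescentLU4.lean` because the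
tree names are shifted by one
(FILE 9 = `InvariantDescentLU` + `InvariantDescentLU2` by the writer's cap split, FILE 10 = `InvariantDescentLU3`);
accordingly the first import is
`…Theorems.InvariantDescentLU3` (= FILE 10 in the tree) instead of `…Theorems.InvariantDescentLU2`. Namespace and
every declaration VERBATIM;
`--supports stmt-ResolutionOfSingularities-0641 --as helper`.
-/

open Polynomial Literature.AlgebraicGeometry.Resolution
open Summit.ResolutionOfSingularities.ResolutionOfSingularities.Theorems.InertDescentLU

namespace Summit.ResolutionOfSingularities.ResolutionOfSingularities.Theorems.InvariantDescentLU

universe u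

variable {E : Type u} [Field E] (OE : ValuationSubring E)

/-! ### S10. Orbit sums -/

section OrbitSum

variable (H : Finset (E ≃+* E))

/-- Reindexing a sum over `H` by left multiplication. [folklore] -/
theorem sum_mul_left_eq {M : Type*} [AddCommMonoid M] (hmul : ∀ g ∈ H, ∀ h ∈ H, g * h ∈ H)
    {g : E ≃+* E} (hg : g ∈ H) (F : (E ≃+* E) → M) :
    ∑ h ∈ H, F (g * h) = ∑ h ∈ H, F h := by
  classical
  conv_rhs => rw [← image_mul_left_eq H hmul hg]
  rw [Finset.sum_image fun a _ b _ hab => mul_right_injective g hab]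

/-- The orbit sum `∑_{h ∈ H} h z` is `H`-invariant. [folklore] -/
theorem apply_orbitSum_eq (hmul : ∀ g ∈ H, ∀ h ∈ H, g * h ∈ H) {g : E ≃+* E} (hg : g ∈ H) (z : E) :
    g (∑ h ∈ H, h z) = ∑ h ∈ H, h z := by
  rw [map_sum]
  have : ∑ h ∈ H, g (h z) = ∑ h ∈ H, (g * h) z := Finset.sum_congr rfl fun h _ => rfl
  rw [this]
  exact sum_mul_left_eq H hmul hg fun h => h z

/-- The orbit sum lies in the fixed field `K = E^H`. [folklore] -/
theorem orbitSum_mem_fixedField {K : Subfield E} (hmul : ∀ g ∈ H, ∀ h ∈ H, g * h ∈ H)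
    (hK : ∀ z, z ∈ K ↔ ∀ h ∈ H, h z = z) (z : E) : (∑ h ∈ H, h z) ∈ K :=
  (hK _).mpr fun _ hg => apply_orbitSum_eq H hmul hg z

end OrbitSum

/-! ### S11. Galois coordinates and the descent identity -/

section GaloisCoordinates

variable {H : Finset (E ≃+* E)} {T₁ : Subring E}

/-- `ℓ₁(h x) = δ_{h,1}` for the Lagrange basis polynomial at the node `x = 1·x`. [folklore] -/
theorem eval_lagrangeBasis_one [DecidableEq (E ≃+* E)] (h1 : (1 : E ≃+* E) ∈ H) {x : E}
    (hinj : Set.InjOn (fun g : E ≃+* E => g x) (H : Set (E ≃+* E))) {h : E ≃+* E} (hh : h ∈ H) :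
    (Lagrange.basis H (fun g : E ≃+* E => g x) 1).eval (h x) = if h = 1 then 1 else 0 := by
  split_ifs with e
  · subst e
    exact Lagrange.eval_basis_self hinj h1
  · exact Lagrange.eval_basis_of_ne (v := fun g : E ≃+* E => g x) (fun e' => e e'.symm) hh

/-- **GALOIS COORDINATES / DESCENT IDENTITY.**  For every `n ∈ E`:
`n = ∑_{i < |H|} a_i · ∑_{h ∈ H} h(x^i n)` with `a_i` the coefficients of `ℓ₁`. [folklore; CHR Galois coordinates] [folklore] -/
theorem eq_sum_coeff_mul_orbitSum [DecidableEq (E ≃+* E)] (h1 : (1 : E ≃+* E) ∈ H)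
    (hmul : ∀ g ∈ H, ∀ h ∈ H, g * h ∈ H) (hHO : ∀ h ∈ H, ∀ z : E, z ∈ OE ↔ h z ∈ OE) {x : E}
    (hsep : ∀ h ∈ H, h ≠ 1 → OE.valuation (x - h x) = 1) (n : E) :
    n = ∑ i ∈ Finset.range H.card,
      (Lagrange.basis H (fun g : E ≃+* E => g x) 1).coeff i * ∑ h ∈ H, h (x ^ i * n) := by
  have hinj := injOn_nodes OE h1 hmul hHO hsep (x := x)
  set ℓ : E[X] := Lagrange.basis H (fun g : E ≃+* E => g x) 1 with hℓ
  -- `ℓ(z) = ∑_{i < |H|} a_i z^i`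
  have hdeg : ℓ.natDegree < H.card := by
    rw [hℓ, Lagrange.natDegree_basis hinj h1]
    exact Nat.sub_lt (Finset.card_pos.mpr ⟨1, h1⟩) one_pos
  have heval : ∀ z : E, ℓ.eval z = ∑ i ∈ Finset.range H.card, ℓ.coeff i * z ^ i := fun z =>
    eval_eq_sum_range' hdeg z
  -- swap the sums
  have hswap : ∑ i ∈ Finset.range H.card, ℓ.coeff i * ∑ h ∈ H, h (x ^ i * n) =
      ∑ h ∈ H, ℓ.eval (h x) * h n := by
    simp_rw [Finset.mul_sum, map_mul, map_pow]
    rw [Finset.sum_comm]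
    refine Finset.sum_congr rfl fun h _ => ?_
    rw [heval, Finset.sum_mul]
    refine Finset.sum_congr rfl fun i _ => ?_
    ring
  rw [hswap, ← Finset.add_sum_erase H _ h1]
  rw [eval_lagrangeBasis_one h1 hinj h1, if_pos rfl, one_mul]
  have hrest : ∑ h ∈ H.erase 1, ℓ.eval (h x) * h n = 0 := by
    refine Finset.sum_eq_zero fun h hh => ?_
    obtain ⟨hne, hhH⟩ := Finset.mem_erase.mp hh
    rw [eval_lagrangeBasis_one h1 hinj hhH, if_neg hne, zero_mul]
  rw [hrest, add_zero]
  rfl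

/-- **ÉTALE DESCENT OF STABLE MODULES (Lagrange descent).**  An additive subgroup `N ⊆ E` stable under `H` and
under multiplication by the local ring `(T₁)_𝔪′` is generated over `(T₁)_𝔪′` by its `H`-FIXED elements:
every `n ∈ N` is `∑_{i<k} a_i m_i` with `a_i ∈ (T₁)_𝔪′`, `m_i ∈ N ∩ K`.  No hypothesis on `|H|`.
[folklore; Chase–Harrison–Rosenberg Galois descent, explicit] [folklore] -/
theorem exists_sum_fixed_of_stable {K : Subfield E} (h1 : (1 : E ≃+* E) ∈ H)
    (hmul : ∀ g ∈ H, ∀ h ∈ H, g * h ∈ H) (hK : ∀ z, z ∈ K ↔ ∀ h ∈ H, h z = z)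
    (hHO : ∀ h ∈ H, ∀ z : E, z ∈ OE ↔ h z ∈ OE) (hT₁H : ∀ h ∈ H, ∀ z ∈ T₁, h z ∈ T₁)
    {x : E} (hx : x ∈ T₁) (hsep : ∀ h ∈ H, h ≠ 1 → OE.valuation (x - h x) = 1)
    (N : AddSubgroup E) (hNC : ∀ c ∈ locAtCentre T₁ OE, ∀ n ∈ N, c * n ∈ N)
    (hNH : ∀ h ∈ H, ∀ n ∈ N, h n ∈ N) {n : E} (hn : n ∈ N) :
    ∃ (k : ℕ) (a m : ℕ → E),
      (∀ i, a i ∈ locAtCentre T₁ OE ∧ m i ∈ N ∧ m i ∈ K) ∧ n = ∑ i ∈ Finset.range k, a i * m i := by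
  classical
  refine ⟨H.card, fun i => (Lagrange.basis H (fun g : E ≃+* E => g x) 1).coeff i,
    fun i => ∑ h ∈ H, h (x ^ i * n), fun i => ⟨?_, ?_, ?_⟩, ?_⟩
  · exact coeff_lagrangeBasis_mem OE h1 hmul hHO hT₁H hx hsep h1 i
  · refine N.sum_mem fun h hh => hNH h hh _ ?_
    exact hNC _ (le_locAtCentre T₁ OE (T₁.pow_mem hx i)) _ hn
  · exact orbitSum_mem_fixedField H hmul hK _
  · exact eq_sum_coeff_mul_orbitSum OE h1 hmul hHO hsep n

/-- The fixed elements produced by Lagrange descent, in closed form: the ORBIT SUMS `∑_h h(x^i n)` — so a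
stable module is generated by `|H|` explicit fixed elements per generator. [folklore] -/
theorem mem_span_orbitSum [DecidableEq (E ≃+* E)] (h1 : (1 : E ≃+* E) ∈ H)
    (hmul : ∀ g ∈ H, ∀ h ∈ H, g * h ∈ H) (hHO : ∀ h ∈ H, ∀ z : E, z ∈ OE ↔ h z ∈ OE)
    (hT₁H : ∀ h ∈ H, ∀ z ∈ T₁, h z ∈ T₁) {x : E} (hx : x ∈ T₁)
    (hsep : ∀ h ∈ H, h ≠ 1 → OE.valuation (x - h x) = 1) (n : E) :
    ∃ a : ℕ → E, (∀ i, a i ∈ locAtCentre T₁ OE) ∧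
      n = ∑ i ∈ Finset.range H.card, a i * ∑ h ∈ H, h (x ^ i * n) :=
  ⟨fun i => (Lagrange.basis H (fun g : E ≃+* E => g x) 1).coeff i,
    fun i => coeff_lagrangeBasis_mem OE h1 hmul hHO hT₁H hx hsep h1 i,
    eq_sum_coeff_mul_orbitSum OE h1 hmul hHO hsep n⟩

end GaloisCoordinates

end Summit.ResolutionOfSingularities.ResolutionOfSingularities.Theorems.InvariantDescentLU
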